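import Mathlib
import HarnessLib
import Literature.MathematicalPhysics.QuantumLattice.GaugeGroups
import Literature.LinearAlgebra.Matrix.UnitaryGroupMaximalTorus
import Literature.LinearAlgebra.Matrix.SpecialUnitaryGroupConjugacyClasses
import Summits.Ventures.LatticeQCDFlow.Exactness.SU2A0Marginal
import Summits.Ventures.LatticeQCDFlow.Exactness.SpectralKernelJacobianWeylShapeSU
import Summits.Ventures.LatticeQCDFlow.Exactness.SU2TorusAlcoveJacobian
import Summits.Ventures.LatticeQCDFlow.Exactness.WeylIntegralFormulaSU2
import Summits.Ventures.LatticeQCDFlow.Exactness.SU2SpectralCouplingLayerUnconditional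

/-!
# The `SU(2)` spectral kernel with the density the engine books, `g'(a) · sin²(g a)/sin²(a)`, is an exact transport of Haar — every auxiliary object eliminated

HONEST FRAMING: exact (Metropolis-corrected) sampling algorithms for lattice gauge theory;
figures of merit are autocorrelation/cost numbers at stated couplings and volumes; no
continuum-physics claim.

Venture `LatticeQCDFlow` (cell pub-lqcd), topic `Exactness`; FANOUT row 10 (`eng-equiv`, engine
`latflow.equiv` `spectral.spectral_kernel`, `N = 2`: `ldj = log_haar(x') − log_haar(x) + ld_chi`
with `log_haar(x) = log(4 sin²a)`, `a` = half the eigen-phase gap, `a' = π(1 − χ(1 − a/π))`,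
`ld_chi = log χ'(1 − a/π)`; Boyda et al., PRD 103 (2021) 074504, App. B Algorithm 2 step 10).  NEW
WORK of the cell: the last bookkeeping step after `SU2SpectralCouplingLayerUnconditional.lean` —
the torus map `fT`, the torus density `Jf` and Boyda's identity `hJ` are CONSTRUCTED / PROVED here
from the eigenvalue map alone, and the Jacobian is the explicit class function the engine books.
Nothing is cited as a fact; no number; no definition.

## What is typed (`c : U(1) → SΔ(2)` the chart `z ↦ diag(z, z⁻¹)`, hypothesis `hc`)

* `alcoveMap_zero`, `alcoveMap_pi`, `sin_alcoveMap_eq_zero` — a monotone `g` with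
  `g '' [0,π] = [0,π]` fixes the walls `0`, `π`;
* `exists_torusMap_su2` — the torus map `fT` (`fT t = diag(f(t_00, t_11))`) of an eigenvalue map
  given on the alcove EXISTS, built chamber by chamber;
* `bookedDensity_identity_su2` — Boyda's identity for the booked density on both chambers;
* **`hasJacobian_spectralKernel_su2_booked`** — for `f` continuous on the unimodular torus with
  `f(e^{±ia}, e^{∓ia}) = (e^{±ig(a)}, e^{∓ig(a)})` (`g` measurable, monotone, onto `[0,π]`,
  derivative `g' ≥ 0` within `[0,π]`, measurable) and ANY kernel `h` following the spectral recipe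
  of `f`:  `HasJacobian (Haar SU(2)) h J` with the BOOKED density
  `J(W) = g'(a_W) · sin²(g a_W) / sin²(a_W)`, `a_W = arccos(Re tr W / 2)` — nothing else assumed;
* **`hasJacobian_spectralKernel_su2_booked_boxFlow`** — the same in the engine's box coordinate:
  `g(a) = π(1 − χ(1 − a/π))`, `g'(a) = χ'(1 − a/π)` for a monotone `χ` of `[0,1]` onto itself with
  derivative `χ' ≥ 0` within `[0,1]`.

NOT here: `N ≥ 3`; any number.
-/

noncomputable section

namespace Summit.Ventures.LatticeQCDFlow.Exactness

open MeasureTheory Matrix Topology Set Real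
open Literature.LinearAlgebra.Matrix
open Literature.MathematicalPhysics.QuantumFieldTheory (haarProbability)
open scoped ENNReal

/-! ## A monotone self-map of the alcove onto itself fixes the walls -/

/-- `g(0) = 0`. -/
theorem alcoveMap_zero {g : ℝ → ℝ} (hmono : MonotoneOn g (Icc 0 π)) (himage : g '' Icc 0 π = Icc 0 π) :
    g 0 = 0 := by
  have h0 : (0 : ℝ) ∈ g '' Icc 0 π := by rw [himage]; exact ⟨le_rfl, pi_pos.le⟩
  obtain ⟨x, hx, hgx⟩ := h0
  have hg0 : g 0 ∈ Icc 0 π := by rw [← himage]; exact ⟨0, ⟨le_rfl, pi_pos.le⟩, rfl⟩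
  have hle : g 0 ≤ g x := hmono ⟨le_rfl, pi_pos.le⟩ hx hx.1
  rw [hgx] at hle
  exact le_antisymm hle hg0.1

/-- `g(π) = π`. -/
theorem alcoveMap_pi {g : ℝ → ℝ} (hmono : MonotoneOn g (Icc 0 π)) (himage : g '' Icc 0 π = Icc 0 π) :
    g π = π := by
  have h0 : (π : ℝ) ∈ g '' Icc 0 π := by rw [himage]; exact ⟨pi_pos.le, le_rfl⟩
  obtain ⟨x, hx, hgx⟩ := h0
  have hgπ : g π ∈ Icc 0 π := by rw [← himage]; exact ⟨π, ⟨pi_pos.le, le_rfl⟩, rfl⟩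
  have hle : g x ≤ g π := hmono hx ⟨pi_pos.le, le_rfl⟩ hx.2
  rw [hgx] at hle
  exact le_antisymm hgπ.2 hle

/-- At a wall the image is a wall: for `a ∈ [0, π]`, `sin a = 0 ⇒ sin (g a) = 0`. -/
theorem sin_alcoveMap_eq_zero {g : ℝ → ℝ} (hmono : MonotoneOn g (Icc 0 π)) (himage : g '' Icc 0 π = Icc 0 π)
    {a : ℝ} (ha : a ∈ Icc 0 π) (hsin : Real.sin a = 0) : Real.sin (g a) = 0 := by
  by_cases hπ : a = π
  · rw [hπ, alcoveMap_pi hmono himage, Real.sin_pi]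
  · have hlt : a < π := lt_of_le_of_ne ha.2 hπ
    have ha0 : a = 0 :=
      (Real.sin_eq_zero_iff_of_lt_of_lt (by linarith [ha.1, pi_pos]) hlt).mp hsin
    rw [ha0, alcoveMap_zero hmono himage, Real.sin_zero]

/-! ## `SU(2)`: the torus map and the booked density -/

section SU2

variable {c : Circle → specialDiagonalTorus (Fin 2)}
  (hc : ∀ z, (((c z : specialDiagonalTorus (Fin 2)) : Matrix.specialUnitaryGroup (Fin 2) ℂ) :
    Matrix (Fin 2) (Fin 2) ℂ) = diagonal ![(z : ℂ), ((z⁻¹ : Circle) : ℂ)])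

include hc

/-- **The torus map exists**: an eigenvalue map given on both chambers of the alcove by `g` has a
torus map `fT` (`fT t = diag(f(t_00, t_11))`) — defined chamber by chamber through the chart. -/
theorem exists_torusMap_su2 {f : (Fin 2 → ℂ) → (Fin 2 → ℂ)} {g : ℝ → ℝ}
    (hfpos : ∀ a ∈ Icc 0 π, f ![(Circle.exp a : ℂ), (((Circle.exp a)⁻¹ : Circle) : ℂ)] =
      ![(Circle.exp (g a) : ℂ), (((Circle.exp (g a))⁻¹ : Circle) : ℂ)])
    (hfneg : ∀ a ∈ Icc 0 π, f ![(Circle.exp (-a) : ℂ), (((Circle.exp (-a))⁻¹ : Circle) : ℂ)] =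
      ![(Circle.exp (-(g a)) : ℂ), (((Circle.exp (-(g a)))⁻¹ : Circle) : ℂ)]) :
    ∃ fT : specialDiagonalTorus (Fin 2) → specialDiagonalTorus (Fin 2), ∀ t : specialDiagonalTorus (Fin 2),
      ((fT t : Matrix.specialUnitaryGroup (Fin 2) ℂ) : Matrix (Fin 2) (Fin 2) ℂ) =
        diagonal (f fun i => ((t : Matrix.specialUnitaryGroup (Fin 2) ℂ) : Matrix (Fin 2) (Fin 2) ℂ) i i) := by
  have hsurj := (su2TorusChart_surjective_continuous hc).1
  classical
  choose w hw using hsurj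
  refine ⟨fun t => if 0 ≤ Complex.arg ((w t : Circle) : ℂ) then
      c (Circle.exp (g (Complex.arg ((w t : Circle) : ℂ)))) else
      c (Circle.exp (-(g (-(Complex.arg ((w t : Circle) : ℂ)))))), fun t => ?_⟩
  have hzθ : Circle.exp (Complex.arg ((w t : Circle) : ℂ)) = w t := Circle.exp_arg (w t)
  have hθ2 : Complex.arg ((w t : Circle) : ℂ) ≤ π := Complex.arg_le_pi _
  have hθ1 : -π < Complex.arg ((w t : Circle) : ℂ) := Complex.neg_pi_lt_arg _
  have hentries : (fun i => ((t : Matrix.specialUnitaryGroup (Fin 2) ℂ) : Matrix (Fin 2) (Fin 2) ℂ) i i) =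
      ![((w t : Circle) : ℂ), (((w t)⁻¹ : Circle) : ℂ)] := by
    have h := su2TorusChart_entries hc (w t)
    rwa [hw t] at h
  rw [hentries]
  dsimp only
  split_ifs with h0
  · rw [hc]
    conv_rhs => rw [← hzθ]
    rw [hfpos _ ⟨h0, hθ2⟩]
  · rw [hc]
    have hθ' : -Complex.arg ((w t : Circle) : ℂ) ∈ Icc 0 π := ⟨by linarith, by linarith⟩
    conv_rhs => rw [← hzθ, show Complex.arg ((w t : Circle) : ℂ) = -(-Complex.arg ((w t : Circle) : ℂ)) by ring]
    rw [hfneg _ hθ']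

omit hc in
/-- **Boyda's identity for the booked density, one chamber**: with `D = 2 sin²`, `a ∈ [0, π]`,
`g` fixing the walls and `g'(a) ≥ 0`:
`(g'(a) sin²(g a)/sin²(a)) · 2 sin²(a) = g'(a) · 2 sin²(g a)` in `ℝ≥0∞` (both sides vanish at a wall). -/
theorem bookedDensity_identity_su2 {g g' : ℝ → ℝ} (hmono : MonotoneOn g (Icc 0 π))
    (himage : g '' Icc 0 π = Icc 0 π) {a : ℝ} (ha : a ∈ Icc 0 π) (hg'0 : 0 ≤ g' a) :
    ENNReal.ofReal (g' a * Real.sin (g a) ^ 2 / Real.sin a ^ 2) * ENNReal.ofReal (2 * Real.sin a ^ 2) =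
      ENNReal.ofReal (g' a) * ENNReal.ofReal (2 * Real.sin (g a) ^ 2) := by
  by_cases hsin : Real.sin a = 0
  · rw [sin_alcoveMap_eq_zero hmono himage ha hsin, hsin]
    simp
  · rw [← ENNReal.ofReal_mul (by positivity), ← ENNReal.ofReal_mul hg'0]
    congr 1
    field_simp

/-- **The `SU(2)` spectral kernel with the booked density is an exact transport of Haar.**  Let `f`
be continuous on the unimodular torus and given on the alcove by a measurable monotone `g` of
`[0, π]` onto itself with measurable derivative `g' ≥ 0` within `[0, π]`
(`f(e^{±ia}, e^{∓ia}) = (e^{±ig(a)}, e^{∓ig(a)})`), and let `h : SU(2) → SU(2)` follow the spectral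
recipe of `f` (`h(V diag(d) V⋆) = V diag(f d) V⋆`).  Then
`HasJacobian (Haar SU(2)) h (W ↦ g'(a_W) sin²(g a_W)/sin²(a_W))`, `a_W = arccos(Re tr W/2)`:
pushing `J · Haar` through the kernel gives back Haar, with `J` exactly the engine's `exp(ldj)`. -/
theorem hasJacobian_spectralKernel_su2_booked
    {f : (Fin 2 → ℂ) → (Fin 2 → ℂ)} (hfc : ContinuousOn f {d | ∀ i, ‖d i‖ = 1})
    {g g' : ℝ → ℝ} (hg : Measurable g) (hg' : Measurable g')
    (hderiv : ∀ a ∈ Icc 0 π, HasDerivWithinAt g (g' a) (Icc 0 π) a) (hmono : MonotoneOn g (Icc 0 π))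
    (himage : g '' Icc 0 π = Icc 0 π) (hg'0 : ∀ a ∈ Icc 0 π, 0 ≤ g' a)
    (hfpos : ∀ a ∈ Icc 0 π, f ![(Circle.exp a : ℂ), (((Circle.exp a)⁻¹ : Circle) : ℂ)] =
      ![(Circle.exp (g a) : ℂ), (((Circle.exp (g a))⁻¹ : Circle) : ℂ)])
    (hfneg : ∀ a ∈ Icc 0 π, f ![(Circle.exp (-a) : ℂ), (((Circle.exp (-a))⁻¹ : Circle) : ℂ)] =
      ![(Circle.exp (-(g a)) : ℂ), (((Circle.exp (-(g a)))⁻¹ : Circle) : ℂ)])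
    {h : Matrix.specialUnitaryGroup (Fin 2) ℂ → Matrix.specialUnitaryGroup (Fin 2) ℂ}
    (hagree : ∀ (P : Matrix.specialUnitaryGroup (Fin 2) ℂ) (V : Matrix (Fin 2) (Fin 2) ℂ) (d : Fin 2 → ℂ),
      V ∈ Matrix.unitaryGroup (Fin 2) ℂ → (P : Matrix (Fin 2) (Fin 2) ℂ) = V * diagonal d * star V →
        ((h P : Matrix.specialUnitaryGroup (Fin 2) ℂ) : Matrix (Fin 2) (Fin 2) ℂ) = V * diagonal (f d) * star V) :
    HasJacobian (haarProbability (Matrix.specialUnitaryGroup (Fin 2) ℂ)) h fun W =>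
      ENNReal.ofReal (g' (Real.arccos (su2a0 W)) * Real.sin (g (Real.arccos (su2a0 W))) ^ 2 /
        Real.sin (Real.arccos (su2a0 W)) ^ 2) := by
  obtain ⟨fT, hfT⟩ := exists_torusMap_su2 hc hfpos hfneg
  have hsurj := (su2TorusChart_surjective_continuous hc).1
  -- the torus density `Jf t = g'(arccos a₀(t))`
  have hα : Measurable fun W : Matrix.specialUnitaryGroup (Fin 2) ℂ => Real.arccos (su2a0 W) :=
    Real.continuous_arccos.measurable.comp continuous_su2a0.measurable
  have hJfm : Measurable fun t : specialDiagonalTorus (Fin 2) =>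
      ENNReal.ofReal (g' (Real.arccos (su2a0 (t : Matrix.specialUnitaryGroup (Fin 2) ℂ)))) :=
    ENNReal.measurable_ofReal.comp (hg'.comp (hα.comp measurable_subtype_coe))
  have hJm : Measurable fun W : Matrix.specialUnitaryGroup (Fin 2) ℂ =>
      ENNReal.ofReal (g' (Real.arccos (su2a0 W)) * Real.sin (g (Real.arccos (su2a0 W))) ^ 2 /
        Real.sin (Real.arccos (su2a0 W)) ^ 2) :=
    ENNReal.measurable_ofReal.comp (((hg'.comp hα).mul
      ((Real.continuous_sin.measurable.comp (hg.comp hα)).pow_const 2)).div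
        ((Real.continuous_sin.measurable.comp hα).pow_const 2))
  have ha0pos : ∀ a : ℝ, su2a0 ((c (Circle.exp a) : specialDiagonalTorus (Fin 2)) :
      Matrix.specialUnitaryGroup (Fin 2) ℂ) = Real.cos a := su2a0_su2TorusChart_exp hc
  refine hasJacobian_spectralKernel_su2_of_alcoveMap hc hfc hg hg' hderiv hmono himage hfpos hfneg hagree hfT
    hJfm (fun a ha => by simp only [ha0pos, Real.arccos_cos ha.1 ha.2])
    (fun a ha => by simp only [ha0pos, Real.cos_neg, Real.arccos_cos ha.1 ha.2]) hJm fun k t => ?_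
  -- Boyda's identity on the torus, chamber by chamber
  obtain ⟨z, hzt⟩ := hsurj t
  obtain ⟨θ, hθ1, hθ2, hzθ⟩ : ∃ θ : ℝ, -π < θ ∧ θ ≤ π ∧ Circle.exp θ = z :=
    ⟨Complex.arg (z : ℂ), Complex.neg_pi_lt_arg _, Complex.arg_le_pi _, Circle.exp_arg z⟩
  rw [su2a0_conj]
  by_cases h0 : 0 ≤ θ
  · have ha : θ ∈ Icc 0 π := ⟨h0, hθ2⟩
    rw [← hzt, ← hzθ, ha0pos, Real.arccos_cos ha.1 ha.2, vandermondeWeight_su2TorusChart_exp hc,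
      torusMap_su2TorusChart hc hfT (hfpos θ ha), vandermondeWeight_su2TorusChart_exp hc]
    exact bookedDensity_identity_su2 hmono himage ha (hg'0 θ ha)
  · obtain ⟨a, rfl⟩ : ∃ a : ℝ, θ = -a := ⟨-θ, (neg_neg θ).symm⟩
    have ha : a ∈ Icc 0 π := ⟨by linarith, by linarith⟩
    rw [← hzt, ← hzθ, ha0pos, Real.cos_neg, Real.arccos_cos ha.1 ha.2, vandermondeWeight_su2TorusChart_exp hc,
      torusMap_su2TorusChart hc hfT (hfneg a ha), vandermondeWeight_su2TorusChart_exp hc]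
    simp only [Real.sin_neg, neg_sq]
    exact bookedDensity_identity_su2 hmono himage ha (hg'0 a ha)

/-- **The engine's box coordinate (`spectral_kernel`, `N = 2`).**  For a measurable monotone `χ` of
`[0, 1]` onto itself with measurable derivative `χ' ≥ 0` within `[0, 1]`, an eigenvalue map `f`
continuous on the unimodular torus with alcove map `a ↦ π(1 − χ(1 − a/π))` on both chambers, and
any kernel `h` following the spectral recipe of `f`:
`HasJacobian (Haar SU(2)) h (W ↦ χ'(1 − a_W/π) · sin²(π(1 − χ(1 − a_W/π))) / sin²(a_W))`,
`a_W = arccos(Re tr W / 2)` — the density `exp(ldj)` booked by `spectral_kernel` for `N = 2`. -/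
theorem hasJacobian_spectralKernel_su2_booked_boxFlow
    {f : (Fin 2 → ℂ) → (Fin 2 → ℂ)} (hfc : ContinuousOn f {d | ∀ i, ‖d i‖ = 1})
    {χ χ' : ℝ → ℝ} (hχ : Measurable χ) (hχ' : Measurable χ')
    (hderiv : ∀ u ∈ Icc (0 : ℝ) 1, HasDerivWithinAt χ (χ' u) (Icc 0 1) u)
    (hmono : MonotoneOn χ (Icc 0 1)) (himage : χ '' Icc 0 1 = Icc 0 1) (hχ'0 : ∀ u ∈ Icc (0 : ℝ) 1, 0 ≤ χ' u)
    (hfpos : ∀ a ∈ Icc 0 π, f ![(Circle.exp a : ℂ), (((Circle.exp a)⁻¹ : Circle) : ℂ)] =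
      ![(Circle.exp (π * (1 - χ (1 - a / π))) : ℂ), (((Circle.exp (π * (1 - χ (1 - a / π))))⁻¹ : Circle) : ℂ)])
    (hfneg : ∀ a ∈ Icc 0 π, f ![(Circle.exp (-a) : ℂ), (((Circle.exp (-a))⁻¹ : Circle) : ℂ)] =
      ![(Circle.exp (-(π * (1 - χ (1 - a / π)))) : ℂ),
        (((Circle.exp (-(π * (1 - χ (1 - a / π)))))⁻¹ : Circle) : ℂ)])
    {h : Matrix.specialUnitaryGroup (Fin 2) ℂ → Matrix.specialUnitaryGroup (Fin 2) ℂ}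
    (hagree : ∀ (P : Matrix.specialUnitaryGroup (Fin 2) ℂ) (V : Matrix (Fin 2) (Fin 2) ℂ) (d : Fin 2 → ℂ),
      V ∈ Matrix.unitaryGroup (Fin 2) ℂ → (P : Matrix (Fin 2) (Fin 2) ℂ) = V * diagonal d * star V →
        ((h P : Matrix.specialUnitaryGroup (Fin 2) ℂ) : Matrix (Fin 2) (Fin 2) ℂ) = V * diagonal (f d) * star V) :
    HasJacobian (haarProbability (Matrix.specialUnitaryGroup (Fin 2) ℂ)) h fun W =>
      ENNReal.ofReal (χ' (1 - Real.arccos (su2a0 W) / π) *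
        Real.sin (π * (1 - χ (1 - Real.arccos (su2a0 W) / π))) ^ 2 / Real.sin (Real.arccos (su2a0 W)) ^ 2) := by
  have hπ : (0 : ℝ) < π := pi_pos
  have hu_mem : ∀ a ∈ Icc 0 π, 1 - a / π ∈ Icc (0 : ℝ) 1 := by
    intro a ha
    constructor
    · rw [sub_nonneg, div_le_one hπ]; exact ha.2
    · rw [sub_le_self_iff]; exact div_nonneg ha.1 hπ.le
  have hu_maps : MapsTo (fun a : ℝ => 1 - a / π) (Icc 0 π) (Icc 0 1) := fun a ha => hu_mem a ha
  have hu_deriv : ∀ a, HasDerivWithinAt (fun a : ℝ => 1 - a / π) (-(1 / π)) (Icc 0 π) a := fun a =>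
    (((hasDerivAt_id' a).div_const π).const_sub 1).hasDerivWithinAt
  refine hasJacobian_spectralKernel_su2_booked hc hfc (g := fun a => π * (1 - χ (1 - a / π)))
    (g' := fun a => χ' (1 - a / π)) ?_ ?_ ?_ ?_ ?_ ?_ hfpos hfneg hagree
  · exact measurable_const.mul (measurable_const.sub (hχ.comp (measurable_const.sub
      (measurable_id.div_const π))))
  · exact hχ'.comp (measurable_const.sub (measurable_id.div_const π))
  · intro a ha
    have hcomp : HasDerivWithinAt (fun a : ℝ => χ (1 - a / π)) (χ' (1 - a / π) * -(1 / π)) (Icc 0 π) a :=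
      (hderiv _ (hu_mem a ha)).comp a (hu_deriv a) hu_maps
    have h := (hcomp.const_sub 1).const_mul π
    have h' : π * (-(χ' (1 - a / π) * -(1 / π))) = χ' (1 - a / π) := by field_simp
    rw [h'] at h
    exact h
  · intro a ha b hb hab
    have h1 : 1 - b / π ≤ 1 - a / π := by
      apply sub_le_sub_left
      exact div_le_div_of_nonneg_right hab hπ.le
    have h2 := hmono (hu_mem b hb) (hu_mem a ha) h1
    exact mul_le_mul_of_nonneg_left (sub_le_sub_left h2 1) hπ.le
  · ext y
    constructor
    · rintro ⟨a, ha, rfl⟩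
      have hχa : χ (1 - a / π) ∈ Icc (0 : ℝ) 1 := by
        rw [← himage]; exact ⟨_, hu_mem a ha, rfl⟩
      constructor
      · exact mul_nonneg hπ.le (sub_nonneg.mpr hχa.2)
      · calc π * (1 - χ (1 - a / π)) ≤ π * 1 := by
              apply mul_le_mul_of_nonneg_left _ hπ.le; linarith [hχa.1]
          _ = π := mul_one π
    · intro hy
      have hv : 1 - y / π ∈ Icc (0 : ℝ) 1 := hu_mem y hy
      rw [← himage] at hv
      obtain ⟨u, hu, huv⟩ := hv
      refine ⟨π * (1 - u), ⟨mul_nonneg hπ.le (sub_nonneg.mpr hu.2), ?_⟩, ?_⟩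
      · calc π * (1 - u) ≤ π * 1 := by apply mul_le_mul_of_nonneg_left _ hπ.le; linarith [hu.1]
          _ = π := mul_one π
      · have hu' : 1 - π * (1 - u) / π = u := by field_simp; ring
        simp only [hu', huv]
        field_simp
        ring
  · exact fun a ha => hχ'0 _ (hu_mem a ha)

end SU2

end Summit.Ventures.LatticeQCDFlow.Exactness
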